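import Summits.BirchSwinnertonDyer.BirchSwinnertonDyer.Theses.PrintCFram
import Summits.BirchSwinnertonDyer.BirchSwinnertonDyer.Theses.RamifiedSevenEllipticUnits
import Summits.BirchSwinnertonDyer.Rank1Residual.X12.CMSevenAwayFromSeven
import HarnessLib

set_option linter.dupNamespace false
set_option autoImplicit false

/-!
# Route `PrintCFram`, crux C2 `BottomClassIndexLawFiveLe` (item stmt-BirchSwinnertonDyer-20372) and support r9
# `EllipticUnitIMCFiveLe` (item 20373): their 𝒞₇@7 INSTANCES are cell `bsd-cm`'s attacked items 19945
# `RamifiedSevenEllipticUnits.EllipticUnitValueSevenOfGZK` and 19944 `…EllipticUnitIMCSevenZp` — IN THE KERNEL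
# (cell `bsd-print-cfram`, seat `bsd-line-cfram-p1`, LEAD g3; helper `--supports` 20372; THEOREMS ONLY)

HONEST FRAMING. Nothing about BSD is proved here; no summit statement is proved by this seat. Both route files
SAY in prose that K7r item 19945 is «the 𝒞₇@7 instance» of C2 (`Theses/PrintCFram.lean`, docstring of
`BottomClassIndexLawFiveLe`: «K7r item 19945 `EllipticUnitValueSevenOfGZK` is its 𝒞₇@7 instance (attacked there
by line rubin-formula-zp); this route cites and never duplicates that attack») and that 19944 is the 𝒞₇@7
instance of r9; this file makes the two edges kernel theorems, so that

* a proof of C2 closes 19945 by `ellipticUnitValueSevenOfGZK_of_bottomClassIndexLawFiveLe` (one line), and a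
  proof of r9 closes 19944 by `ellipticUnitIMCSevenZp_of_ellipticUnitIMCFiveLe`;
* conversely a REFUTATION of 19945 (cell `bsd-cm`'s falsifier programme on 𝒞₇: the β digit table, `D = −79`,
  see the docstring of `EllipticUnitValueSevenOfGZK`) refutes C2 at once
  (`not_bottomClassIndexLawFiveLe_of_not_ellipticUnitValueSevenOfGZK`), and a refutation of 19944 refutes r9;
* C2 cannot land before 19945 does: every line on C2 in `BSD_p` currency contains the 𝒞₇@7 instance, which is
  the object of cell `bsd-cm`'s registered line «rubin-formula-zp» (skeleton v46, stubs
  `stub_rubinPackageReducedSevenZp` / `stub_printFactsHeckeDeuringSevenLine` / `stub_archimedeanValuationSevenZp`).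

The class 𝒞₇ (`X12.ClassCSeven W`: CM field `ℚ(√−7)`, analytic rank one, good ordinary at `2`, every bad prime
`q ≠ 7` split in `K`) is a SUB-family of the `(p, j) = (7, −3375), (7, 16581375)` members of the `@≥5` leaf; the
edges use only `ClassCSeven.cmRamified_seven` (`7 ∣ d_K = −7`), `h.1 : W.HasCM`, `h.2.2.1 : r_an = 1` and `5 ≤ 7`.
The last theorem records the composite edge to K7r's (R-EU)@7 item `EllipticUnitIndexSeven` (stmt-19143) through
cell `bsd-cm`'s proved seam `O11.ramifiedCMEllipticUnitIndexAt_of_imcZp_of_indexLawZp`, under C2's own published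
antecedent GZK (`rank_eq_analyticRank_of_analyticRank_le_one`, displayed, not discharged — CONDITIONAL).

References: route files `Theses/PrintCFram.lean` (rev ≥ 21; items 20372, 20373) and
`Theses/RamifiedSevenEllipticUnits.lean` (items 19945, 19944, 19143); R. Miller, LMS J. Comput. Math. 14 (2011)
Def. 1.1 [Miller2011LMS]; [BKNO] arXiv:2608.06879v1 §1.4 (p. 8: «report elsewhere»), Thm. 1.7, Thm. 1.8 (shape
only; preprint) [BurungaleKobayashiNakamuraOta2026]; V. A. Kolyvagin (1990) Thm. A [Kolyvagin1990].
-/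

namespace Summit.BirchSwinnertonDyer.BirchSwinnertonDyer.Theorems.PrintCFram.SevenInstance

open Summit.BirchSwinnertonDyer.BirchSwinnertonDyer.Theses
open Summit.BirchSwinnertonDyer.Rank1Residual.X12

/-- **C2 ⟹ K7r item 19945 (the 𝒞₇@7 instance), BY NAME.** If the class-wide bottom-class value law
`PrintCFram.BottomClassIndexLawFiveLe` holds (every globally minimal CM `W/ℚ` of analytic rank one, every
CM-ramified `p ≥ 5`, under GZK), then cell `bsd-cm`'s attacked crux
`RamifiedSevenEllipticUnits.EllipticUnitValueSevenOfGZK` holds: a 𝒞₇ curve has CM (`h.1`), `7` ramified in its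
CM field (`ClassCSeven.cmRamified_seven`), analytic rank one (`h.2.2.1`), and `5 ≤ 7`; the conclusion
`X12.O11.RamifiedCMBottomClassIndexLawAtZp W 7` is literally the same. Nothing is asserted about either side.
[cite: Miller2011LMS, Def. 1.1 (arXiv:1010.2431 p. 3)] -/
theorem ellipticUnitValueSevenOfGZK_of_bottomClassIndexLawFiveLe
    (h : PrintCFram.BottomClassIndexLawFiveLe) :
    RamifiedSevenEllipticUnits.EllipticUnitValueSevenOfGZK := by
  intro hGZK W _ _ _ hC
  exact h hGZK W 7 hC.1 (ClassCSeven.cmRamified_seven hC) (by norm_num) hC.2.2.1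

/-- **Contrapositive: a refutation of K7r item 19945 refutes C2.** (For the refuter lane: a landed
`¬ EllipticUnitValueSevenOfGZK` gives `¬ BottomClassIndexLawFiveLe` by this term.)
[cite: Miller2011LMS, Def. 1.1 (arXiv:1010.2431 p. 3)] -/
theorem not_bottomClassIndexLawFiveLe_of_not_ellipticUnitValueSevenOfGZK
    (h : ¬ RamifiedSevenEllipticUnits.EllipticUnitValueSevenOfGZK) :
    ¬ PrintCFram.BottomClassIndexLawFiveLe :=
  fun h' => h (ellipticUnitValueSevenOfGZK_of_bottomClassIndexLawFiveLe h')

/-- **r9 ⟹ K7r item 19944 (the 𝒞₇@7 instance of the `∃`-form elliptic-unit IMC), BY NAME.** If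
`PrintCFram.EllipticUnitIMCFiveLe` holds then `RamifiedSevenEllipticUnits.EllipticUnitIMCSevenZp` holds, by the
same four bookkeeping facts about 𝒞₇. Nothing is asserted about either side.
[cite: BurungaleKobayashiNakamuraOta2026, Thm. 1.7 and Prop. 3.7 (arXiv:2608.06879 pp. 6, 20) (shape only; claim; preprint)] -/
theorem ellipticUnitIMCSevenZp_of_ellipticUnitIMCFiveLe
    (h : PrintCFram.EllipticUnitIMCFiveLe) :
    RamifiedSevenEllipticUnits.EllipticUnitIMCSevenZp := by
  intro W _ _ _ hC
  exact h W 7 hC.1 (ClassCSeven.cmRamified_seven hC) (by norm_num) hC.2.2.1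

/-- **Contrapositive: a refutation of K7r item 19944 refutes r9.**
[cite: BurungaleKobayashiNakamuraOta2026, Thm. 1.7 (arXiv:2608.06879 p. 6) (shape only; claim; preprint)] -/
theorem not_ellipticUnitIMCFiveLe_of_not_ellipticUnitIMCSevenZp
    (h : ¬ RamifiedSevenEllipticUnits.EllipticUnitIMCSevenZp) :
    ¬ PrintCFram.EllipticUnitIMCFiveLe :=
  fun h' => h (ellipticUnitIMCSevenZp_of_ellipticUnitIMCFiveLe h')

/-- **C2 ∧ r9 ⟹ K7r's (R-EU)@7 item `EllipticUnitIndexSeven` (stmt-19143), under GZK.** Pointwise cell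
`bsd-cm`'s proved seam `O11.ramifiedCMEllipticUnitIndexAt_of_imcZp_of_indexLawZp` (the pinned datum and
exponent `c` from the IMC piece, `n₀ + log₇ #X[T] = c` from its identity, `c = n + n' + ord₇ q + ord₇ q'` from
the value law). CONDITIONAL on the displayed published antecedent GZK of C2
(`rank_eq_analyticRank_of_analyticRank_le_one`: Gross–Zagier 1986 + Kolyvagin 1990), which
`EllipticUnitIndexSeven` does not carry. [cite: Kolyvagin1990, Thm. A] [cite: Miller2011LMS, Def. 1.1 (arXiv:1010.2431 p. 3)] -/
theorem ellipticUnitIndexSeven_of_bottomClassIndexLawFiveLe_of_ellipticUnitIMCFiveLe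
    (hGZK : Literature.NumberTheory.EllipticCurves.rank_eq_analyticRank_of_analyticRank_le_one)
    (h₂ : PrintCFram.BottomClassIndexLawFiveLe) (h₃ : PrintCFram.EllipticUnitIMCFiveLe) :
    RamifiedSevenEllipticUnits.EllipticUnitIndexSeven := by
  intro W _ _ _ hC
  exact O11.ramifiedCMEllipticUnitIndexAt_of_imcZp_of_indexLawZp
    (h₃ W 7 hC.1 (ClassCSeven.cmRamified_seven hC) (by norm_num) hC.2.2.1)
    (h₂ hGZK W 7 hC.1 (ClassCSeven.cmRamified_seven hC) (by norm_num) hC.2.2.1)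

end Summit.BirchSwinnertonDyer.BirchSwinnertonDyer.Theorems.PrintCFram.SevenInstance
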